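import Summits.QuantumFields.YangMills.Theorems.ColdStartUniversalityShenZhuZhuWeightedW2ContractionSU2
import Summits.QuantumFields.YangMills.Theorems.ColdStartUniversalityShenZhuZhuTorusWeights
import HarnessLib

/-!
# SHEN–ZHU–ZHU'S LEMMA 5.1 (the weighted coupling estimate behind Theorem 1.2) for `SU(2)`, `d = 3`:
# the named fact `shenZhuZhu_weightedContraction (fundamentalLatticeRep 2) 3` VERBATIM is a THEOREM of the tree

Seat `ym-line-csu-p1` (g43), route `ColdStartUniversality` of `Summits/QuantumFields/YangMills`, helper file (`--supports stmt-QuantumFields-24809`).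
Assembly: the weighted `W₂` Dirac contraction `szzDiracContraction_wW2_su2` (Kuwada duality from the WEIGHTED Bakry–Émery gradient bound, files
`…LatticeLangevinWeighted*`, `…ShenZhuZhuWeightedW2ContractionSU2`) at `b = √a` with the torus weights `w_e = Σ_(torusEdge ẽ = e) a^(−|ẽ|)` of
`…ShenZhuZhuTorusWeights` (positive, plaquette ratio `≤ a`, and `ρ_(∞,a)(torusLift U, torusLift U')² = Σ_e w_e ρ(U_e,U'_e)²`), and the rate comparison
`K̃_𝒮 = 1 − 16(1+√a)|β| ≤ 1 − (4 + 6(a+1)/√a)|2β|` (`a ≥ 1`).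
* `szzDiracContraction_mono_rate` — the conclusion shape is monotone in the rate;
* `szzErgodicRateSU_two_three`, `szzErgodicRateSU_le_weightedRate`, `abs_two_mul_lt_of_szzErgodicRateSU_pos` — the printed rate for `N = 2`, `d = 3`;
* ★★★★★ **`shenZhuZhu_weightedContraction_su2 : shenZhuZhu_weightedContraction (fundamentalLatticeRep 2) 3`** — SZZ Lemma 5.1 in the Literature's
  Dirac form: for every `a > 1`, `β` with `K̃_𝒮 > 0`, `L > 1`, any two strong solutions of the `SU(2)` lattice Langevin SDE on `(ℤ/L)³` (coupling `2β`) from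
  `Q`, `Q̄`: `W₂^(ρ_(∞,a)∘torusLift)(law U_t, law U'_t)² ≤ e^(−2K̃_𝒮 t) ρ_(∞,a)(Q,Q̄)²` (`SU` conjunct; the `SO` conjunct is vacuous, `K̃_𝒮(SO(2)) ≤ 0`).
THEOREMS ONLY, no definition, no sorry.  HONEST FRAMING: this discharges the instance `(SU(2), d = 3)` of a named Literature fact about the FIXED-`β`
lattice dynamics, uniformly in the volume `L` — it is Shen–Zhu–Zhu's large-`1/β` (high-temperature) regime `K̃_𝒮 > 0`; nothing `K`-uniform along the
route's scaling `β'_K → ∞`; `UniformColdStartMixing` (24809, ASIDE) is not restated and not proved; no crux, rung or summit statement is proved; the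
Yang–Mills mass gap is NOT proved.  The proof route (Kuwada duality + weighted Γ₂) replaces the paper's Kendall–Cranston coupling and improves the
rate constant (`6(a+1)/√a + 4 ≤ 8 + 8√a`).
-/

set_option autoImplicit false

noncomputable section

namespace Summit.QuantumFields.YangMills.Theorems.ColdStartUniversality

open MeasureTheory ProbabilityTheory Matrix Complex Finset Filter Topology Set Metric
open scoped BigOperators NNReal ENNReal
open Literature.MathematicalPhysics.QuantumFieldTheory
open Literature.MathematicalPhysics.QuantumLattice (fundamentalRep fundamentalLatticeRep continuous_fundamentalRep fundamentalRep_apply fundamentalLatticeRep_N)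

variable {L : ℕ} [NeZero L]

/-! ## §1. Monotonicity in the rate; the printed rate for `N = 2`, `d = 3` -/

/-- The conclusion shape `SZZDiracContraction` is monotone in the rate (for a nonnegative cost). [cite: ShenZhuZhuCMP2023, (4.5)] -/
theorem szzDiracContraction_mono_rate (L : ℕ) [NeZero L] (β' : ℝ) {K K' : ℝ} (hK : K' ≤ K)
    {c : GaugeConfig 3 L (Matrix.specialUnitaryGroup (Fin 2) ℂ) → GaugeConfig 3 L (Matrix.specialUnitaryGroup (Fin 2) ℂ) → ℝ} (hc : ∀ U U', 0 ≤ c U U')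
    (h : SZZDiracContraction (fundamentalLatticeRep 2) 3 L β' K c) : SZZDiracContraction (fundamentalLatticeRep 2) 3 L β' K' c := by
  intro Ω _ P _ W hW U Q hU0 hU Ω' _ P' _ W' hW' U' Q' hU'0 hU' t
  refine (h Ω P W hW U Q hU0 hU Ω' P' W' hW' U' Q' hU'0 hU' t).trans (ENNReal.ofReal_le_ofReal ?_)
  refine mul_le_mul_of_nonneg_right (Real.exp_le_exp.2 ?_) (hc Q Q')
  have ht : 0 ≤ (t : ℝ) := t.2
  nlinarith

/-- `K̃_𝒮(a) = 1 − 16(1+√a)|β|` for `SU(2)`, `d = 3`. [cite: ShenZhuZhuCMP2023, Lemma 5.1] -/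
theorem szzErgodicRateSU_two_three (a β : ℝ) : szzErgodicRateSU a 2 3 β = 1 - 16 * (1 + Real.sqrt a) * |β| := by
  unfold szzErgodicRateSU szzRicciConstSU; norm_num; ring

/-- The printed rate is below the weighted Bakry–Émery rate at `b = √a`: `1 − 16(1+√a)|β| ≤ 1 − (4 + 6(√a²+1)/√a)|2β|` for `a ≥ 1`
(`⟺ 12/√a ≤ 8 + 4√a`). [cite: ShenZhuZhuCMP2023, Lemma 5.1] -/
theorem szzErgodicRateSU_le_weightedRate {a : ℝ} (ha : 1 ≤ a) (β : ℝ) :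
    szzErgodicRateSU a 2 3 β ≤ 1 - (4 + 6 * ((Real.sqrt a ^ 2 + 1) / Real.sqrt a)) * |2 * β| := by
  rw [szzErgodicRateSU_two_three, abs_mul, abs_two]
  have hs : 1 ≤ Real.sqrt a := Real.one_le_sqrt.2 ha
  have hs0 : 0 < Real.sqrt a := by linarith
  have hfrac : (Real.sqrt a ^ 2 + 1) / Real.sqrt a = Real.sqrt a + 1 / Real.sqrt a := by field_simp
  have h12 : 1 / Real.sqrt a ≤ 1 := by rw [div_le_one hs0]; exact hs
  rw [hfrac]
  have hβ : 0 ≤ |β| := abs_nonneg β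
  have hkey : (4 + 6 * (Real.sqrt a + 1 / Real.sqrt a)) * 2 ≤ 16 * (1 + Real.sqrt a) := by nlinarith
  nlinarith

/-- `K̃_𝒮 > 0` (with `a ≥ 1`) forces `|β'| = |2β| < 1/16 < 1/12`. [cite: ShenZhuZhuCMP2023, Lemma 5.1] -/
theorem abs_two_mul_lt_of_szzErgodicRateSU_pos {a : ℝ} (ha : 1 ≤ a) {β : ℝ} (hK : 0 < szzErgodicRateSU a 2 3 β) : |2 * β| < 1 / 12 := by
  rw [szzErgodicRateSU_two_three] at hK
  have hs : 1 ≤ Real.sqrt a := Real.one_le_sqrt.2 ha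
  rw [abs_mul, abs_two]
  have hβ : 0 ≤ |β| := abs_nonneg β
  nlinarith

/-! ## §2. The named fact -/

/-- ★★★★★ **THE NAMED FACT `shenZhuZhu_weightedContraction (fundamentalLatticeRep 2) 3` IS A THEOREM.**  Shen–Zhu–Zhu's Lemma 5.1 (the volume-uniform
weighted coupling estimate behind Theorem 1.2) for `SU(2)` in its fundamental representation on `(ℤ/L)³`: for every `a > 1` and `β` with
`K̃_𝒮 = szzErgodicRateSU a 2 3 β > 0`, every `L > 1`, and any two strong solutions of `latticeLangevinDynamics (fundamentalLatticeRep 2) (2β)` from `Q`, `Q̄`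
(each on its own filtered probability space): the coupling infimum of `E ρ_(∞,a)(torusLift U_t, torusLift U'_t)²` is at most `e^(−2K̃_𝒮 t)·ρ_(∞,a)(Q,Q̄)²`
for all `t ≥ 0` (`SZZDiracContraction … (weightedRiemannDistSq r a ∘ torusLift)`); the `SO` conjunct is vacuous.  Proof: the torus form of
`ρ_(∞,a)∘torusLift` is `d_w` with the torus weights (`weightedRiemannDistSq_torusLift_eq`), `d_w` contracts at the weighted Bakry–Émery rate
`1 − (4 + 6(a+1)/√a)|2β| ≥ K̃_𝒮` (`szzDiracContraction_wW2_su2` at `b = √a`), and the shape is monotone in the rate.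
[cite: ShenZhuZhuCMP2023, Lemma 5.1 / (5.13)] [cite: BakryGentilLedoux2014, Thm 9.7.2] -/
theorem shenZhuZhu_weightedContraction_su2 : shenZhuZhu_weightedContraction (fundamentalLatticeRep 2) 3 := by
  intro _ a ha
  refine ⟨fun _ β hK L _ _ => ?_, fun _ β hK => ?_⟩
  · have hN : (fundamentalLatticeRep 2).N = 2 := fundamentalLatticeRep_N 2
    have hK2 : 0 < szzErgodicRateSU a 2 3 β := by rwa [hN] at hK
    have hcast : ((fundamentalLatticeRep 2).N : ℝ) * β = 2 * β := by rw [hN]; norm_num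
    rw [hcast, hN]
    classical
    -- the torus weights of `ρ_(∞,a)`
    obtain ⟨w, hw⟩ : ∃ w : Edge 3 L → ℝ, w = fun e => (∑' et : {et : Literature.MathematicalPhysics.QuantumLattice.ZdEdge 3 // Literature.MathematicalPhysics.QuantumLattice.torusEdge L et = e}, (a ^ edgeLevel et.1)⁻¹) := ⟨_, rfl⟩
    have hwpos : ∀ e, 0 < w e := fun e => by rw [hw]; exact torusWeight_pos ha e
    obtain ⟨e₀, he₀⟩ := Finite.exists_min w
    obtain ⟨e₁, he₁⟩ := Finite.exists_max w
    have hb : 1 ≤ Real.sqrt a := Real.one_le_sqrt.2 ha.le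
    have hwb : ∀ (p : Plaquette 3 L) (e e' : Edge 3 L), e ∈ ({(p.1, p.2.1.1), (p.1.shift p.2.1.1, p.2.1.2), (p.1.shift p.2.1.2, p.2.1.1), (p.1, p.2.1.2)} : Finset (Edge 3 L)) → e' ∈ ({(p.1, p.2.1.1), (p.1.shift p.2.1.1, p.2.1.2), (p.1.shift p.2.1.2, p.2.1.1), (p.1, p.2.1.2)} : Finset (Edge 3 L)) → w e ≤ Real.sqrt a ^ 2 * w e' := by
      intro p e e' he he'
      rw [Real.sq_sqrt (by linarith), hw]
      exact torusWeight_plaquette_le ha p e e' he he'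
    have hβ' : |2 * β| < 1 / 12 := abs_two_mul_lt_of_szzErgodicRateSU_pos ha.le hK2
    have hcontr := szzDiracContraction_wW2_su2 L (2 * β) (Real.sqrt a) hb hβ' w (hwpos e₀) he₀ he₁ hwb
    have hcost : (fun U U' : GaugeConfig 3 L (Matrix.specialUnitaryGroup (Fin 2) ℂ) => weightedRiemannDistSq (fundamentalLatticeRep 2) a (Literature.MathematicalPhysics.QuantumLattice.torusLift L U) (Literature.MathematicalPhysics.QuantumLattice.torusLift L U')) =
        fun U U' : GaugeConfig 3 L (Matrix.specialUnitaryGroup (Fin 2) ℂ) => ∑ e : Edge 3 L, w e * (fundamentalLatticeRep 2).riemannDist (U e) (U' e) ^ 2 := by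
      funext U U'; rw [hw]; exact weightedRiemannDistSq_torusLift_eq (fundamentalLatticeRep 2) ha U U'
    rw [hcost]
    exact szzDiracContraction_mono_rate L (2 * β) (szzErgodicRateSU_le_weightedRate ha.le β)
      (fun U U' => Finset.sum_nonneg fun e _ => mul_nonneg (hwpos e).le (sq_nonneg _)) hcontr
  · exfalso
    have hN : (fundamentalLatticeRep 2).N = 2 := fundamentalLatticeRep_N 2
    rw [hN] at hK
    unfold szzErgodicRateSO szzRicciConstSO at hK
    norm_num at hK
    nlinarith [abs_nonneg β, Real.sqrt_nonneg a, mul_nonneg (Real.sqrt_nonneg a) (abs_nonneg β)]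

end Summit.QuantumFields.YangMills.Theorems.ColdStartUniversality
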